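import Mathlib
import HarnessLib
import Literature.AlgebraicGeometry.Ramification.InertiaNormalSylow
import Literature.AlgebraicGeometry.Resolution.AugmentationIdeal
import Summits.ResolutionOfSingularities.ResolutionOfSingularities.Theorems.WildQuotientsWildQuotientResolutionTameFixedLocus
import Summits.ResolutionOfSingularities.ResolutionOfSingularities.Theorems.WildQuotientsWildQuotientResolutionCotangentRep
import Summits.ResolutionOfSingularities.ResolutionOfSingularities.Theorems.WildQuotientsWildQuotientResolutionToralEndState

/-!
# Through every non-p-closed point passes a REGULAR TAME CENTRE OF CODIMENSION ≥ 2
# (crux `WildQuotients.WildQuotientResolution`, stub `stub_phaseZeroHighDim`; any dimension)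

Crux stmt-ResolutionOfSingularities-15640 (`WildQuotientResolution`), registered stub `stub_phaseZeroHighDim`.
Assembly of this hand's tame layer: ✓`CotangentRep.exists_tame_fixedIdeal_two_le` (p820427: at a non-p-closed point
some tame `t ∈ ⟨p-elements⟩` of the inertia group has a fixed-locus ideal with `≥ 2` independent differentials),
✓`TameFixedLocus` (p817669: the fixed-locus ideal of a tame cyclic group on a regular local ring is generated by a
part of a regular system of parameters, the quotient is regular local) and ✓`ToralEndState` (p820081: the stalk
action of `I_x` is faithful and residue-trivial) give:

**Theorem** (`exists_tame_rsopPart_two_le`, local form; `exists_tame_centre_of_not_hasNormalSylow`, scheme form).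
Let `(A, 𝔪, κ)` be a REGULAR local ring of residue characteristic `p` with a faithful residue-trivial action `τ`
of a finite group `I` which is NOT p-closed. Then there is `t ∈ ⟨p-elements⟩ ≤ I`, `t ≠ 1`, of order prime to
`p`, whose fixed-locus ideal `I_{τ t}` is generated by a part `f₁, …, f_c` of a regular system of parameters with
`c ≥ 2`, so that `A ⧸ I_{τ t}` is regular local with `dim (A ⧸ I_{τ t}) + c = dim A`: the fixed locus of `t` is a
REGULAR CENTRE OF CODIMENSION ≥ 2 through the point. Scheme form: at every point `x` of an integral locally
Noetherian `G`-scheme (faithful action over a separated base) with regular local ring of residue characteristic `p`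
and NON-p-closed inertia group, such a `t ∈ I_x` exists for the stalk action.

So the tame layer never lacks a move at a non-p-closed point; what remains of the all-dimensional Phase 0 (R-B′ of
the evidence memo PHASE0-TAME-CENTRE-ORDER.md) is the ORDER of these moves and the `G`-equivariant choice of the
centre (orbit regularity), i.e. termination.

[OURS · crux stmt-ResolutionOfSingularities-15640 · helper toward `stub_phaseZeroHighDim`; folklore, counted 0;
AI-level work, weaker than expert review.] [folklore]
-/

-- single-problem summit: the doubled namespace component `ResolutionOfSingularities` is forced
set_option linter.dupNamespace false

noncomputable section

namespace Summit.ResolutionOfSingularities.ResolutionOfSingularities.Theorems.WildQuotientResolution.CotangentRep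

open IsLocalRing Literature.AlgebraicGeometry.Ramification Literature.AlgebraicGeometry.Resolution
open CategoryTheory AlgebraicGeometry

/-! ## Local form -/

section Local

variable {A : Type*} [CommRing A]

/-- The fixed-locus ideals of the powers of an automorphism lie in that of the automorphism:
`σʲ r − r = Σ_{i<j} (σ (σⁱ r) − σⁱ r)`. [folklore] -/
theorem augIdeal_pow_le (σ : A ≃+* A) (j : ℕ) : augIdeal (σ ^ j) ≤ augIdeal σ := by
  rw [augIdeal_def, Ideal.span_le]
  rintro _ ⟨r, rfl⟩
  show (σ ^ j) r - r ∈ augIdeal σ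
  induction j with
  | zero => simp
  | succ j ih =>
    have e : (σ ^ (j + 1)) r - r = (σ ((σ ^ j) r) - (σ ^ j) r) + ((σ ^ j) r - r) := by
      rw [pow_succ', RingAut.mul_apply]; ring
    rw [e]
    exact add_mem (sub_mem_augIdeal σ _) ih

/-- The fixed-locus ideal of the cyclic group generated by `t` is the fixed-locus ideal of `t`. [folklore] -/
theorem iSup_augIdeal_zpowers {I : Type*} [Group I] [Finite I] (τ : I →* (A ≃+* A)) (t : I) :
    (⨆ k : Subgroup.zpowers t, augIdeal ((τ.comp (Subgroup.zpowers t).subtype) k)) = augIdeal (τ t) := by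
  apply le_antisymm
  · refine iSup_le fun k => ?_
    obtain ⟨k, hk⟩ := k
    obtain ⟨j, rfl⟩ := (Submonoid.mem_powers_iff _ _).mp
      (((isOfFinOrder_of_finite t).mem_powers_iff_mem_zpowers).mpr hk)
    rw [MonoidHom.comp_apply, Subgroup.subtype_apply, map_pow]
    exact augIdeal_pow_le (τ t) j
  · have h := le_iSup (fun k : Subgroup.zpowers t => augIdeal ((τ.comp (Subgroup.zpowers t).subtype) k))
      ⟨t, Subgroup.mem_zpowers t⟩
    simpa using h

/-- **Local form: a regular tame centre of codimension ≥ 2 at a non-p-closed point.** Let `(A, 𝔪, κ)` be a regular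
local ring of residue characteristic `p`, `τ` a faithful residue-trivial action of a finite group `I` which is not
p-closed. Then some `t ∈ ⟨p-elements⟩ ≤ I`, `t ≠ 1`, of order prime to `p`, has `I_{τ t} = (f₁, …, f_c)` for a part
`f` of a regular system of parameters with `2 ≤ c` (hence `A ⧸ I_{τ t}` regular local of codimension `c ≥ 2`).
[folklore] -/
theorem exists_tame_rsopPart_two_le [IsRegularLocalRing A] {I : Type*} [Group I] [Finite I]
    (τ : I →* (A ≃+* A)) (hres : ∀ (g : I) (a : A), τ g a - a ∈ maximalIdeal A) (p : ℕ) [Fact p.Prime]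
    [CharP (ResidueField A) p] (hτ : Function.Injective τ) (hI : ¬ HasNormalSylow p I) :
    ∃ t ∈ Subgroup.closure {g : I | ∃ n : ℕ, g ^ p ^ n = 1}, (orderOf t).Coprime p ∧ t ≠ 1 ∧
      ∃ (c : ℕ) (f : Fin c → A), IsRsopPart f ∧ Ideal.span (Set.range f) = augIdeal (τ t) ∧ 2 ≤ c ∧
        IsRegularLocalRing (A ⧸ augIdeal (τ t)) ∧
        ringKrullDim (A ⧸ augIdeal (τ t)) + (c : WithBot ℕ∞) = ringKrullDim A := by
  classical
  have hp : p.Prime := Fact.out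
  obtain ⟨t, htN, htc, ht1, h2⟩ := exists_tame_fixedIdeal_two_le τ hres p hτ hI
  refine ⟨t, htN, htc, ht1, ?_⟩
  -- the cyclic group `⟨t⟩` is tame: its fixed-locus ideal is cut out by a part of a regular system of parameters
  set K := Subgroup.zpowers t with hKdef
  let τ' : K →* (A ≃+* A) := τ.comp K.subtype
  have hcard : IsUnit ((Nat.card K : ℕ) : A) := by
    rw [hKdef, Nat.card_zpowers]
    exact TameFixedLocus.isUnit_natCast_of_not_dvd p ((Nat.Prime.coprime_iff_not_dvd hp).mp htc.symm)
  have heq : (⨆ k : K, augIdeal (τ' k)) = augIdeal (τ t) := iSup_augIdeal_zpowers τ t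
  have hm : (⨆ k : K, augIdeal (τ' k)) ≤ maximalIdeal A := by
    rw [heq, augIdeal_def, Ideal.span_le]
    rintro _ ⟨r, rfl⟩
    exact hres t r
  obtain ⟨c, f, hf, hfJ, hspan, hli⟩ := TameFixedLocus.exists_generators_linearIndependent τ' hcard hm
  obtain ⟨e, y, hdim, hsp⟩ := exists_extend_to_rsop f hf
    ((linearIndependent_toCotangent_iff_forall_mem f hf).mp hli)
  have hrsop : IsRsopPart f := ⟨‹IsRegularLocalRing A›, e, y, hdim, hsp⟩
  rw [heq] at hspan hfJ
  refine ⟨c, f, hrsop, hspan, ?_, ?_, ?_⟩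
  · -- `c ≥ 2`: the differentials of `I_{τ t}` lie in the span of the (independent) differentials of the `fᵢ`
    have hle : Submodule.span (ResidueField A)
        ((maximalIdeal A).toCotangent '' {x : maximalIdeal A | (x : A) ∈ augIdeal (τ t)}) ≤
        Submodule.span (ResidueField A)
          (Set.range fun i => (maximalIdeal A).toCotangent ⟨f i, hf i⟩) := by
      rw [Submodule.span_le]
      rintro _ ⟨x, hx, rfl⟩
      have hx' : (x : A) ∈ Ideal.span (Set.range f) := by rw [hspan]; exact hx
      obtain ⟨a, ha⟩ := Ideal.mem_span_range_iff_exists_fun.mp hx'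
      have hxe : x = ∑ i, a i • (⟨f i, hf i⟩ : maximalIdeal A) := by
        apply Subtype.ext
        simp only [AddSubmonoidClass.coe_finsetSum, SetLike.val_smul, smul_eq_mul]
        exact ha.symm
      rw [SetLike.mem_coe, hxe, map_sum]
      refine Submodule.sum_mem _ fun i _ => ?_
      rw [LinearMap.map_smul, ← IsScalarTower.algebraMap_smul (ResidueField A) (a i)]
      exact Submodule.smul_mem _ _ (Submodule.subset_span ⟨i, rfl⟩)
    have hfin := Submodule.finrank_mono hle
    rw [finrank_span_eq_card hli, Fintype.card_fin] at hfin
    exact h2.trans hfin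
  · rw [← heq]
    exact TameFixedLocus.isRegularLocalRing_quotient_iSup_augIdeal τ' hcard hm
  · rw [← hspan]
    exact hrsop.ringKrullDim_quotient_add

end Local

/-! ## Scheme form -/

/-- **A regular tame centre of codimension ≥ 2 through every non-p-closed point** (crux
stmt-ResolutionOfSingularities-15640, toward `stub_phaseZeroHighDim`; any dimension). Let the finite group `G` act
faithfully on the integral locally Noetherian scheme `X` over the separated `r : X → Y`, and let `x ∈ X` have a REGULAR
local ring of residue characteristic `p` and a NON-p-closed inertia group `I_x`. Then for the stalk action `(a, τ)` of
`I_x` (✓`exists_stalkAction`; any such package) there is `t ∈ ⟨p-elements of I_x⟩`, `t ≠ 1`, of order prime to `p`,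
whose fixed-locus ideal `I_{τ t} ⊆ 𝒪_{X,x}` is generated by a part of a regular system of parameters of length
`c ≥ 2`, with `𝒪_{X,x} ⧸ I_{τ t}` regular local and `dim (𝒪_{X,x} ⧸ I_{τ t}) + c = dim 𝒪_{X,x}`. [folklore] -/
theorem exists_tame_centre_of_not_hasNormalSylow {X : Scheme.{0}} {G : Type} [Group G] [Finite G]
    (σ : G →* Aut X) (hσ : Function.Injective σ) [IsIntegral X] [IsLocallyNoetherian X]
    {Y : Scheme.{0}} (r : X ⟶ Y) [IsSeparated r] (hr : ∀ g : G, (σ g).hom ≫ r = r)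
    (p : ℕ) [Fact p.Prime] (x : X) [IsRegularLocalRing (X.presheaf.stalk x)]
    [CharP (ResidueField (X.presheaf.stalk x)) p]
    (hx : ¬ HasNormalSylow p (inertiaSubgroup σ x))
    (a : inertiaSubgroup σ x → (X.presheaf.stalk x ⟶ X.presheaf.stalk x))
    (τ : inertiaSubgroup σ x →* (X.presheaf.stalk x ≃+* X.presheaf.stalk x))
    (hkey : ∀ g : inertiaSubgroup σ x,
      Spec.map (a g) ≫ X.fromSpecStalk x = X.fromSpecStalk x ≫ (σ (g : G)).hom)
    (hτ : ∀ (g : inertiaSubgroup σ x) (s : X.presheaf.stalk x), τ g s = (a g⁻¹).hom s) :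
    ∃ t ∈ Subgroup.closure {g : inertiaSubgroup σ x | ∃ n : ℕ, g ^ p ^ n = 1},
      (orderOf t).Coprime p ∧ t ≠ 1 ∧
      ∃ (c : ℕ) (f : Fin c → X.presheaf.stalk x), IsRsopPart f ∧
        Ideal.span (Set.range f) = augIdeal (τ t) ∧ 2 ≤ c ∧
        IsRegularLocalRing (X.presheaf.stalk x ⧸ augIdeal (τ t)) ∧
        ringKrullDim (X.presheaf.stalk x ⧸ augIdeal (τ t)) + (c : WithBot ℕ∞) =
          ringKrullDim (X.presheaf.stalk x) := by
  have hinj : Function.Injective τ := InertLocusStalk.stalkAction_injective σ x a τ hkey hτ r hr hσ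
  have hres : ∀ (g : inertiaSubgroup σ x) (s : X.presheaf.stalk x),
      τ g s - s ∈ maximalIdeal (X.presheaf.stalk x) :=
    InertLocusStalk.stalkAction_residueTrivial σ x a τ hkey hτ le_rfl
  exact exists_tame_rsopPart_two_le τ hres p hinj hx

end Summit.ResolutionOfSingularities.ResolutionOfSingularities.Theorems.WildQuotientResolution.CotangentRep

end
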